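import Literature.MathematicalPhysics.QuantumFieldTheory.Balaban1983to89.B9Cor35GpDirInputsAtOne
import Literature.MathematicalPhysics.QuantumFieldTheory.Balaban1983to89.B9Eq359CubeKernelsAtOne
import Literature.MathematicalPhysics.QuantumFieldTheory.Balaban1983to89.B9DeltaALocalGaugeCovY
import Literature.MathematicalPhysics.QuantumFieldTheory.Balaban1983to89.Node00.OpsYNablaBridge

/-!
# `Balaban1983to89.B9Eq360PadDeltaCubeY` — [Balaban1985BackgroundPropagators] (3.60) p. 402 AND (3.31)–(3.33) pp. 395–396 FOR PRINT's PADDED DIRICHLET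
# CUBE LETTERS `padΔ_{□,Ω₀}(U) = Ω₀Δ′_{a,□}(U)Ω₀ + (1 − Ω₀)`, `G′_□(U) = (Ω₀Δ′_{a,□}(U)Ω₀)⁻¹` (road P4): the `Ω₀`-SUPPORT of a small-field variation
# `Δ′_{a,□}(1) − Δ′_{a,□}(e^{iηA′}·1)` (print p. 408: the small field lives on `Ω₀(□) ⊂ □⁵`), Theorem 3.4's identity `Δp − conj b V′(A′) =
# conj b(η⁻²·padΔ_{□,Ω₀}(e^{iηA′}·1))` for UNIT 1's letters, the unit read-back, and the gauge covariance of both letters for a transporter obeying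
# print's contour law on the averaging pairs — r05's FILE 7a §1 + `B9CubeLettersCovarianceL0` §SiteSector RE-PRESSED AT THE DIRICHLET LETTER, par-generic —
# sub-row G-B9-LETTERS (site sector), seat dag-n06-c g32 UNIT 3

statement-level skeleton of published theorems with citation tags; proofs where landed; nothing here is a claim about the Yang–Mills mass gap

CITATION HEADER (lean-in-tree rule).  B9 = T. Bałaban, *Propagators for lattice gauge theories in a background field*, Commun. Math. Phys. **99** (1985)
389–434 [Balaban1985BackgroundPropagators] (held `paper:balaban1985-cmp99-background-propagators`; journal page = PDF page + 388): p. 394 l. 24–33 «Δ′_a↾Ω₀ =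
Ω₀Δ′_aΩ₀ … Its inverse is denoted by G′, or G′(U). They depend on the configuration U restricted to Ω₀»; (3.60) p. 402 «Δ′(U′U) + Q′*(U′U)aQ′(U′U) = Δ′(U)
+ Q′*(U)aQ′(U) − V′(A)»; p. 408 (last lines)–p. 409 l. 5 «Ω₀(□) ⊂ □⁵ … the cube □⁵ is contained in one of the cubes for which this condition holds»;
Cor. 3.6 p. 408 «This follows from Corollary 3.5 applied to the configuration U′ = Uᵘ, and we have to recall only that all the results of these theorems
are gauge invariant»; (3.28) p. 395 «R(U^u(Γ_{y,x})) = R(u(y))R(U(Γ_{y,x}))R(u⁻¹(x))»; (3.31)–(3.33) pp. 395–396; (3.24) p. 394; (3.19) p. 393; Thm 3.4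
p. 400.  Rows B9.(3.60) × B9.(3.31)–(3.33) × B9.Cor3.6 (cells only; no row head changes).

WHY THIS FILE (road P4 of the N06 h36b campaign; UNIT 1/2 headers).  UNIT 2's `cor35_GpDir_cube` inverts `Δp − conj b V′(A′)` for the padded `U = 1`
letter `Δp = conj b(η⁻²padΔ_{□,Ω₀}(1))`; to read this as «`padΔ_{□,Ω₀}(e^{iηA′}·1)` is a unit with (3.42) entries» one needs (3.60) for the PADDED letters,
i.e. r05 FILE 1's `η⁻²Δ′_{a,□}(Ṽ) = η⁻²Δ′_{a,□}(1) − V′(A′)` plus the fact that the variation `Δ′_{a,□}(1) − Δ′_{a,□}(Ṽ)` is compressed by `Ω₀(□)` — true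
when the rows touched by `A′` and their stencils lie in `Ω₀(□)` (print: `A′` is the gauge-fixed small field on `Ω₀(□) ⊂ □⁵`, p. 408).  §1–§2 prove the
support statement from the two halves of locality (E's configuration half `deltaPrimeACubeY_apply_congr_of_agree`, and the argument half §1), §3 the
identity and the unit read-back (`B9Eq359CubeKernelsAtOne.isUnit_of_conj_laws`), §4 the covariance Cor. 3.6 invokes, for a transporter obeying (3.28) on the
AVERAGING PAIRS only (the knit tables `parKnitY` ∕ def-Y's `parKnitCubeY` are contour variables there and `1` elsewhere; r05's `deltaPrimeACubeY_cov` asks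
`IsGaugeLawS` everywhere, which knit tables do not satisfy).

WHAT IS PROVED (0 `def`; 0 sorry; 0 new named facts; standard axioms):
* §1 `lapS_congr_arg`, ★`deltaPrimeACubeY_apply_congr_arg` (`(Δ′_{a,□}(U)Λ)(z)` reads `Λ` on `z`, `z ± e_μ`, and the averaging pairs of `z`);
* §2 ★★`compr_sub_compr_eq` — rows agreeing off `S′`, stencils of `S′` inside `S ⊇ S′` ⟹ `Ω₀(Δ′_{a,□}(U) − Δ′_{a,□}(U′))Ω₀ = Δ′_{a,□}(U) − Δ′_{a,□}(U′)`;
  `padDeltaCubeY_eq_sub` (`padΔ_S(U′) = padΔ_S(U) − (Δ′(U) − Δ′(U′))`);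
* §3 ★★`DpDirK_sub_conj_vPrimeConc` (the padded (3.60) in Theorem 3.4's letters, given the §2 compression at `S = Ω₀(□)`, `U = 1`,
  `U′ = e^{iηA′}·1`), ★`isUnit_padDeltaCubeY_of_conj_laws` (two-sided inverse of `Δp − conj b V′` ⟹ `IsUnit (padΔ_{□,Ω₀}(e^{iηA′}·1))`);
* §4 ★`deltaPrimeACubeY_cov_of_pairs`, ★`padDeltaCubeY_cov_of_pairs`, ★★`GpDirY_cov_of_pairs` (`G′_□(U^u)R(u) = R(u)G′_□(U)`), `isUnit_padDeltaCubeY_gaugeY_iff`.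

PROOF.  Ours (bookkeeping).  The support statement is pointwise: a row outside `S′` of the variation vanishes on every argument (configuration half); a row
inside `S′ ⊆ S` survives the left cut and reads its argument inside `S` (argument half), so the right cut is invisible.  §4 is r05's proof with E's
`intw_trLiftY` guard used, then n06-l's `intw_dirPadY` ∕ `intw_dirInvY`.

HONEST SCOPE / NOT CLAIMED.  The geometric discharge of §2's hypotheses (which rows a cut field touches; `Ω₀(□) = dirDomC ⊇ C₁(□)`) and of §4's pair law
for `parKnitCubeY` (def-Y's letter; asked BY NAME on the bus) are NOT here; no estimate; nothing on `d = 4`, the continuum, reflection positivity or the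
mass gap; NOT a node discharge; no row head changes.

RELATED IN THE TREE, NOT DUPLICATED: r05's `B9Cor36GpCubeIsUnit.DpK_sub_conj_vPrimeConc` (same identity for the torus-levelled letter, no support issue),
`B9CubeLettersCovarianceL0.deltaPrimeACubeY_cov` (law everywhere), n06-l's `B9DeltaALocalGaugeCovY` (member-level padded letters `padDeltaY`/`GsqY`; its
generic `intw_dirPadY`/`intw_dirInvY` are used by name), E's locality half (used by name), n06-d's `B9B8KnitLetterCovariance` (member knit letter).
-/

noncomputable section

namespace Literature.MathematicalPhysics.QuantumFieldTheory.Balaban1983to89.B9Eq360PadDeltaCubeY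

open Literature.MathematicalPhysics.QuantumFieldTheory.Balaban1983to89
open Literature.MathematicalPhysics.QuantumFieldTheory.Balaban1983to89.B9Eq352DivFormLetters (conj conj_sub)
open Literature.MathematicalPhysics.QuantumFieldTheory.Balaban1983to89.B9Eq360VprimeLetters (vPrimeConc)
open Literature.MathematicalPhysics.QuantumFieldTheory.Balaban1983to89.B9Eq39Adjoint (R fluct)
open Literature.MathematicalPhysics.QuantumFieldTheory.Balaban1983to89.B6KLevelCensusIndexV1 (KIdx kGeo)
open Literature.MathematicalPhysics.QuantumFieldTheory.Balaban1983to89.B6Cover236MultiLevelBlocks (cubes)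
open Literature.MathematicalPhysics.QuantumFieldTheory.Balaban1983to89.B9Eq360DeltaPrimeAY (mulY AfldY chartA)
open Literature.MathematicalPhysics.QuantumFieldTheory.Balaban1983to89.B9Eq360DeltaPrimeACubeY (blkCubeY kQCubeY sQCubeY cCubeY kFCubeY sFCubeY
  eq360_deltaPrimeACubeY_one)
open Literature.MathematicalPhysics.QuantumFieldTheory.Balaban1983to89.B9CubeLettersOpsL0 (cubeFamY levCubeY avgCoeffCubeY avgTrCubeY deltaPrimeACubeY
  deltaPrimeACubeY_apply)
open Literature.MathematicalPhysics.QuantumFieldTheory.Balaban1983to89.B9CubeGeometryInputs (geoCK geoCK_eta)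
open Literature.MathematicalPhysics.QuantumFieldTheory.Balaban1983to89.B9Cor35GpCubeInputsAtOne (cfunK eta_ne_zero)
open Literature.MathematicalPhysics.QuantumFieldTheory.Balaban1983to89.B9Cor35GpDirInputsAtOne (dirDomY DpDirK GpDirK)
open Literature.MathematicalPhysics.QuantumFieldTheory.Balaban1983to89.B9Eq359CubeKernelsAtOne (isUnit_of_conj_laws)
open Literature.MathematicalPhysics.QuantumFieldTheory.Balaban1983to89.B9DeltaALocalGaugeCovY (intw_dirPadY intw_dirInvY cubeProjY_intw)
open Literature.MathematicalPhysics.QuantumFieldTheory.Balaban1983to89.Node00 (SiteY CfgY GaugeY SiteParY toKT shiftY UboxY lapS cdS cdsS gaugeY gSiteY conjY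
  Intw isUnit_conjY lapSL_cov intw_trLiftY kernelTrOpY_eq_trLiftY IsCovSiteOpY)
open Literature.MathematicalPhysics.QuantumFieldTheory.Balaban1983to89.Node00.OpsYNablaBridge (cdS_apply cdsS_apply)
open Literature.MathematicalPhysics.QuantumFieldTheory.Balaban1983to89.Node00.OpsYLocalInverse (dirPadY cubeProjY cubeProjY_apply)
open Literature.MathematicalPhysics.QuantumFieldTheory.Balaban1983to89.Node00.OpsYCubeDirInverse (padDeltaCubeY GpDirY deltaPrimeACubeY_apply_congr_of_agree)

variable {d ℓ : ℕ} {hd : 1 ≤ d + 1} {hL : Odd (ℓ + 1) ∧ 1 < ℓ + 1} {b₀ b₁ : ℝ}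
variable {𝔸 : Type} [NormedRing 𝔸] [NormedAlgebra ℂ 𝔸] [CompleteSpace 𝔸]

/-! ## §1  The argument half of locality: `(Δ′_{a,□}(U)Λ)(z)` reads `Λ` on `z`, its `2(d+1)` neighbours and the averaging pairs `(z, w)` -/

section Arg

variable (i : KIdx d ℓ hd hL b₀ b₁) (q : ↥(cubes (toKT i).D.toDomains))

/-- the covariant Laplacian at `z` reads its argument at `z` and `z ± e_μ` only. [cite: Balaban1985BackgroundPropagators, (3.23) p.394, (3.3) p.390, (3.8) p.392, bookkeeping] -/
theorem lapS_congr_arg (U : CfgY 𝔸 i) {Λ Λ' : SiteY i → 𝔸} (z : SiteY i) (h0 : Λ z = Λ' z)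
    (h1 : ∀ μ, Λ (shiftY i μ z) = Λ' (shiftY i μ z) ∧ Λ ((shiftY i μ).symm z) = Λ' ((shiftY i μ).symm z)) :
    lapS i U Λ z = lapS i U Λ' z := by
  show (∑ μ, cdsS i U μ (cdS i U μ Λ) z) = ∑ μ, cdsS i U μ (cdS i U μ Λ') z
  refine Finset.sum_congr rfl fun μ _ => ?_
  rw [cdsS_apply, cdsS_apply, cdS_apply, cdS_apply, cdS_apply, cdS_apply, Equiv.apply_symm_apply, h0, (h1 μ).1, (h1 μ).2]

/-- ★ **`(Δ′_{a,□}(U)Λ)(z)` DEPENDS ON `Λ` ONLY ON THE STENCIL OF `z`**: the site, its neighbours and the sites `w` of its averaging block (`avgCoeff(z, w) ≠ 0`).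
[cite: Balaban1985BackgroundPropagators, (3.24) p.394, (3.19) p.393, p.409] -/
theorem deltaPrimeACubeY_apply_congr_arg (par : SiteParY 𝔸 i) (U : CfgY 𝔸 i) {Λ Λ' : SiteY i → 𝔸} (z : SiteY i) (h0 : Λ z = Λ' z)
    (h1 : ∀ μ, Λ (shiftY i μ z) = Λ' (shiftY i μ z) ∧ Λ ((shiftY i μ).symm z) = Λ' ((shiftY i μ).symm z))
    (h2 : ∀ w, avgCoeffCubeY i q z w ≠ 0 → Λ w = Λ' w) :
    deltaPrimeACubeY i q par U Λ z = deltaPrimeACubeY i q par U Λ' z := by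
  rw [deltaPrimeACubeY_apply, deltaPrimeACubeY_apply, lapS_congr_arg i U z h0 h1]
  congr 1
  refine Finset.sum_congr rfl fun w _ => ?_
  by_cases hw : avgCoeffCubeY i q z w = 0
  · rw [hw, Complex.ofReal_zero, zero_smul, zero_smul]
  · rw [h2 w hw]

end Arg

/-! ## §2  The `Ω₀`-support of a variation `Δ′_{a,□}(U) − Δ′_{a,□}(U′)`: rows untouched off a set `S′ ⊆ S` whose stencil lies in `S` -/

section Support

variable (i : KIdx d ℓ hd hL b₀ b₁) (q : ↥(cubes (toKT i).D.toDomains))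

/-- ★★ **THE VARIATION IS COMPRESSED BY `Ω₀`**: if two configurations agree (bonds and averaging transporters) at every row outside a set `S′`, and the stencil of
every row of `S′` lies in `S ⊇ S′`, then `Ω₀(Δ′_{a,□}(U) − Δ′_{a,□}(U′))Ω₀ = Δ′_{a,□}(U) − Δ′_{a,□}(U′)` with `Ω₀ = 𝟙_S` (print: the small field `U′ = e^{iηA}`
lives on `Ω₀(□) ⊂ □⁵`, p. 408). [cite: Balaban1985BackgroundPropagators, p.394 («Ω₀Δ′_aΩ₀»), p.408 («Ω₀(□) ⊂ □⁵»), (3.60) p.402, (3.24) p.394] -/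
theorem compr_sub_compr_eq (par : SiteParY 𝔸 i) (S S' : Finset (SiteY i)) {U U' : CfgY 𝔸 i}
    (hrow : ∀ z, z ∉ S' →
      (∀ μ, UboxY i U μ z = UboxY i U' μ z ∧ UboxY i U μ ((shiftY i μ).symm z) = UboxY i U' μ ((shiftY i μ).symm z)) ∧
      (∀ w, avgCoeffCubeY i q z w ≠ 0 → avgTrCubeY i q par U z w = avgTrCubeY i q par U' z w))
    (hS' : S' ⊆ S) (hst : ∀ z ∈ S', (∀ μ, shiftY i μ z ∈ S ∧ (shiftY i μ).symm z ∈ S) ∧ ∀ w, avgCoeffCubeY i q z w ≠ 0 → w ∈ S) :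
    cubeProjY i S * (deltaPrimeACubeY i q par U - deltaPrimeACubeY i q par U') * cubeProjY i S =
      deltaPrimeACubeY i q par U - deltaPrimeACubeY i q par U' := by
  refine LinearMap.ext fun Λ => funext fun z => ?_
  simp only [Module.End.mul_apply, LinearMap.sub_apply, Pi.sub_apply, cubeProjY_apply]
  by_cases hz : z ∈ S'
  · obtain ⟨hnb, hbl⟩ := hst z hz
    rw [if_pos (hS' hz)]
    have key : ∀ V : CfgY 𝔸 i, deltaPrimeACubeY i q par V (cubeProjY i S Λ) z = deltaPrimeACubeY i q par V Λ z := fun V =>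
      deltaPrimeACubeY_apply_congr_arg i q par V z (by rw [cubeProjY_apply, if_pos (hS' hz)])
        (fun μ => ⟨by rw [cubeProjY_apply, if_pos (hnb μ).1], by rw [cubeProjY_apply, if_pos (hnb μ).2]⟩)
        (fun w hw => by rw [cubeProjY_apply, if_pos (hbl w hw)])
    rw [key, key]
  · obtain ⟨hU, hpar⟩ := hrow z hz
    rw [deltaPrimeACubeY_apply_congr_of_agree i q par (cubeProjY i S Λ) z hU hpar, deltaPrimeACubeY_apply_congr_of_agree i q par Λ z hU hpar, sub_self,
      sub_self]
    split_ifs <;> rfl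

/-- hence the padded compressions differ by the bare variation: `padΔ_S(U′) = padΔ_S(U) − (Δ′_{a,□}(U) − Δ′_{a,□}(U′))`.
[cite: Balaban1985BackgroundPropagators, p.394 («Ω₀Δ′_aΩ₀»), (3.60) p.402, bookkeeping] -/
theorem padDeltaCubeY_eq_sub (par : SiteParY 𝔸 i) (S : Finset (SiteY i)) {U U' : CfgY 𝔸 i}
    (h : cubeProjY i S * (deltaPrimeACubeY i q par U - deltaPrimeACubeY i q par U') * cubeProjY i S =
      deltaPrimeACubeY i q par U - deltaPrimeACubeY i q par U') :
    padDeltaCubeY i q par S U' = padDeltaCubeY i q par S U - (deltaPrimeACubeY i q par U - deltaPrimeACubeY i q par U') := by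
  rw [padDeltaCubeY, padDeltaCubeY, dirPadY, dirPadY, ← h, mul_sub, sub_mul]
  abel

end Support

/-! ## §3  ★★ (3.60) for the PADDED Dirichlet letters: `Δp − conj b V′(A′) = conj b(η⁻²·padΔ_{□,Ω₀}(e^{iηA′}·1))` -/

section Identity

variable {ι : Type} [Fintype ι] (b : Module.Basis ι ℝ 𝔸)
variable (i : KIdx d ℓ hd hL b₀ b₁) (c : ↥(cubes (toKT i).D.toDomains)) (par : SiteParY 𝔸 i)

/-- ★★ **(3.60) AT THE DIRICHLET CUBE IN THEOREM 3.4's LETTERS**: with `Ṽ = e^{iηA′}·1` a small field whose variation `Δ′_{a,□}(1) − Δ′_{a,□}(Ṽ)` is compressed by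
`Ω₀(□)` (§2), the engine's `Δp − conj b V′(chartA A′)` (r05 FILE 1's kernels `kF = kQ(Ṽ) − kQ(1)`, `sF = sQ(Ṽ) − sQ(1)`, weight `cfun = η⁻²c_□`) IS
`conj b(η⁻²·padΔ_{□,Ω₀}(Ṽ))` — r05's `B9Cor36GpCubeIsUnit.DpK_sub_conj_vPrimeConc` for the padded letter.
[cite: Balaban1985BackgroundPropagators, (3.60) p.402, (3.24) p.394, p.394 («Ω₀Δ′_aΩ₀»), Cor. 3.5 p.407, p.408 («Ω₀(□) ⊂ □⁵»), p.409 l.1–5] -/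
theorem DpDirK_sub_conj_vPrimeConc (A' : AfldY 𝔸 i)
    (h : cubeProjY i (dirDomY i c) *
        (deltaPrimeACubeY i c par (fun _ _ => 1) - deltaPrimeACubeY i c par (mulY i (fluct (kGeo i).eta A') (fun _ _ => 1))) *
        cubeProjY i (dirDomY i c) =
      deltaPrimeACubeY i c par (fun _ _ => 1) - deltaPrimeACubeY i c par (mulY i (fluct (kGeo i).eta A') (fun _ _ => 1))) :
    DpDirK b i c par - conj b (vPrimeConc (shiftY i) (fun _ _ => (1 : 𝔸ˣ)) (geoCK i c).eta (chartA i A') (blkCubeY i c)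
        (kQCubeY i c par (fun _ _ => 1)) (kFCubeY i c par (fun _ _ => 1) (mulY i (fluct (kGeo i).eta A') (fun _ _ => 1)))
        (sQCubeY i c par (fun _ _ => 1)) (sFCubeY i c par (fun _ _ => 1) (mulY i (fluct (kGeo i).eta A') (fun _ _ => 1))) (cfunK i c)) =
      conj b ((((kGeo i).eta ^ 2)⁻¹) • (padDeltaCubeY i c par (dirDomY i c) (mulY i (fluct (kGeo i).eta A') (fun _ _ => 1))).restrictScalars ℝ) := by
  have hη := eta_ne_zero i
  have hU : UboxY i (fun _ _ => (1 : 𝔸ˣ)) = fun _ _ => 1 := rfl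
  have hc : ((kGeo i).eta ^ 2)⁻¹ • cCubeY i c = cfunK i c := by funext s; rfl
  have e360 := eq360_deltaPrimeACubeY_one i c par hη A'
  rw [hU, hc] at e360
  have eV : vPrimeConc (shiftY i) (fun _ _ => (1 : 𝔸ˣ)) (kGeo i).eta (chartA i A') (blkCubeY i c) (kQCubeY i c par (fun _ _ => 1))
        (kFCubeY i c par (fun _ _ => 1) (mulY i (fluct (kGeo i).eta A') (fun _ _ => 1))) (sQCubeY i c par (fun _ _ => 1))
        (sFCubeY i c par (fun _ _ => 1) (mulY i (fluct (kGeo i).eta A') (fun _ _ => 1))) (cfunK i c) =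
      ((kGeo i).eta ^ 2)⁻¹ • (deltaPrimeACubeY i c par (fun _ _ => 1)).restrictScalars ℝ -
        ((kGeo i).eta ^ 2)⁻¹ • (deltaPrimeACubeY i c par (mulY i (fluct (kGeo i).eta A') (fun _ _ => 1))).restrictScalars ℝ := by
    rw [e360]; abel
  have rs : ∀ X Y : Module.End ℂ (SiteY i → 𝔸), ((X - Y).restrictScalars ℝ : Module.End ℝ (SiteY i → 𝔸)) = X.restrictScalars ℝ - Y.restrictScalars ℝ :=
    fun _ _ => rfl
  rw [geoCK_eta, eV, DpDirK, ← conj_sub, padDeltaCubeY_eq_sub i c par (dirDomY i c) h, rs, rs, smul_sub, smul_sub]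

/-- ★ **READING THE ENGINE BACK**: if `Δp − conj b V′(chartA A′)` has a two-sided inverse (Theorem 3.4 ∕ `cor35_GpDir_cube`), then the padded Dirichlet operator
`padΔ_{□,Ω₀}(e^{iηA′}·1)` IS A UNIT — the regime hypothesis `hU` of every `GpDirY` identity of E. [cite: Balaban1985BackgroundPropagators, Thm 3.4 p.400 («G′(U′U) = (Δ′_a(U′U))⁻¹ exists»), Cor. 3.6 p.408, p.409 l.1–5] -/
theorem isUnit_padDeltaCubeY_of_conj_laws (A' : AfldY 𝔸 i)
    (h : cubeProjY i (dirDomY i c) *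
        (deltaPrimeACubeY i c par (fun _ _ => 1) - deltaPrimeACubeY i c par (mulY i (fluct (kGeo i).eta A') (fun _ _ => 1))) *
        cubeProjY i (dirDomY i c) =
      deltaPrimeACubeY i c par (fun _ _ => 1) - deltaPrimeACubeY i c par (mulY i (fluct (kGeo i).eta A') (fun _ _ => 1)))
    (Y : Module.End ℝ (SiteY i × ι → ℝ))
    (l1 : (DpDirK b i c par - conj b (vPrimeConc (shiftY i) (fun _ _ => (1 : 𝔸ˣ)) (geoCK i c).eta (chartA i A') (blkCubeY i c)
        (kQCubeY i c par (fun _ _ => 1)) (kFCubeY i c par (fun _ _ => 1) (mulY i (fluct (kGeo i).eta A') (fun _ _ => 1)))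
        (sQCubeY i c par (fun _ _ => 1)) (sFCubeY i c par (fun _ _ => 1) (mulY i (fluct (kGeo i).eta A') (fun _ _ => 1))) (cfunK i c))) * Y = 1)
    (l2 : Y * (DpDirK b i c par - conj b (vPrimeConc (shiftY i) (fun _ _ => (1 : 𝔸ˣ)) (geoCK i c).eta (chartA i A') (blkCubeY i c)
        (kQCubeY i c par (fun _ _ => 1)) (kFCubeY i c par (fun _ _ => 1) (mulY i (fluct (kGeo i).eta A') (fun _ _ => 1)))
        (sQCubeY i c par (fun _ _ => 1)) (sFCubeY i c par (fun _ _ => 1) (mulY i (fluct (kGeo i).eta A') (fun _ _ => 1))) (cfunK i c))) = 1) :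
    IsUnit (padDeltaCubeY i c par (dirDomY i c) (mulY i (fluct (kGeo i).eta A') (fun _ _ => 1))) := by
  rw [DpDirK_sub_conj_vPrimeConc b i c par A' h] at l1 l2
  exact isUnit_of_conj_laws b _ (inv_ne_zero (pow_ne_zero 2 (eta_ne_zero i))) _ l1 l2

end Identity

/-! ## §4  Gauge covariance of the padded Dirichlet letters (3.31)–(3.33) for a transporter covariant on the averaging pairs -/

section Cov

variable (i : KIdx d ℓ hd hL b₀ b₁) (q : ↥(cubes (toKT i).D.toDomains)) (g : GaugeY 𝔸 i) (U : CfgY 𝔸 i) {par : SiteParY 𝔸 i}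

variable {i} in
/-- ★ **(3.31)–(3.32) FOR `Δ′_{a,□}(U)` WITH A SUPPORT-SENSITIVE TRANSPORTER LAW**: if the averaging transporters are contour variables on the averaging pairs
(`avgCoeff ≠ 0`; the knit tables obey the law only there), then `Δ′_{a,□}(U^u)R(u) = R(u)Δ′_{a,□}(U)` (r05's `deltaPrimeACubeY_cov` asks the law everywhere).
[cite: Balaban1985BackgroundPropagators, (3.24) p.394, (3.28) p.395, (3.31)–(3.32) p.395, p.409 l.3–5] -/
theorem deltaPrimeACubeY_cov_of_pairs
    (hpar : ∀ z w, avgCoeffCubeY i q z w ≠ 0 → avgTrCubeY i q par (gaugeY i g U) z w = gSiteY i g z * avgTrCubeY i q par U z w * (gSiteY i g w)⁻¹) :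
    Intw (conjY (gSiteY i g)) (conjY (gSiteY i g)) (deltaPrimeACubeY i q par U) (deltaPrimeACubeY i q par (gaugeY i g U)) := by
  unfold deltaPrimeACubeY
  refine (lapSL_cov i g U).add ?_
  rw [kernelTrOpY_eq_trLiftY, kernelTrOpY_eq_trLiftY]
  exact intw_trLiftY _ _ _ _ _ fun z w h => hpar z w h

variable {i} in
/-- ★ **THE PADDED COMPRESSION IS COVARIANT**: `padΔ_S(U^u)R(u) = R(u)padΔ_S(U)` (`Ω₀` a real cut-off). [cite: Balaban1985BackgroundPropagators, p.394 («Ω₀Δ′_aΩ₀»), (3.31) p.395, p.408 («all the results of these theorems are gauge invariant»)] -/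
theorem padDeltaCubeY_cov_of_pairs (S : Finset (SiteY i))
    (hpar : ∀ z w, avgCoeffCubeY i q z w ≠ 0 → avgTrCubeY i q par (gaugeY i g U) z w = gSiteY i g z * avgTrCubeY i q par U z w * (gSiteY i g w)⁻¹) :
    Intw (conjY (gSiteY i g)) (conjY (gSiteY i g)) (padDeltaCubeY i q par S U) (padDeltaCubeY i q par S (gaugeY i g U)) :=
  intw_dirPadY (cubeProjY_intw i _ S) (deltaPrimeACubeY_cov_of_pairs q g U hpar)

variable {i} in
/-- ★★ **(3.33) FOR PRINT's DIRICHLET CUBE INVERSE: `G′_□(U^u)R(u) = R(u)G′_□(U)`** — Cor. 3.6's «all the results of these theorems are gauge invariant» for the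
letter `GpDirY`. [cite: Balaban1985BackgroundPropagators, (3.33) p.396 («G′(U^u) = R(u)G′(U)R(u⁻¹)»), Cor. 3.6 p.408, p.409 l.3–5] -/
theorem GpDirY_cov_of_pairs (S : Finset (SiteY i))
    (hpar : ∀ z w, avgCoeffCubeY i q z w ≠ 0 → avgTrCubeY i q par (gaugeY i g U) z w = gSiteY i g z * avgTrCubeY i q par U z w * (gSiteY i g w)⁻¹) :
    Intw (conjY (gSiteY i g)) (conjY (gSiteY i g)) (GpDirY i q par S U) (GpDirY i q par S (gaugeY i g U)) :=
  intw_dirInvY (isUnit_conjY _) (cubeProjY_intw i _ S) (deltaPrimeACubeY_cov_of_pairs q g U hpar)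

variable {i} in
/-- and the regime transfers: `padΔ_S(U)` is a unit iff `padΔ_S(U^u)` is. [cite: Balaban1985BackgroundPropagators, Cor. 3.6 p.408 («applied to the configuration U′ = Uᵘ»), (3.31) p.395] -/
theorem isUnit_padDeltaCubeY_gaugeY_iff (S : Finset (SiteY i))
    (hpar : ∀ z w, avgCoeffCubeY i q z w ≠ 0 → avgTrCubeY i q par (gaugeY i g U) z w = gSiteY i g z * avgTrCubeY i q par U z w * (gSiteY i g w)⁻¹) :
    IsUnit (padDeltaCubeY i q par S (gaugeY i g U)) ↔ IsUnit (padDeltaCubeY i q par S U) := by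
  have h := padDeltaCubeY_cov_of_pairs q g U S hpar
  have hσ := isUnit_conjY (𝔸 := 𝔸) (gSiteY i g)
  obtain ⟨σu, hσu⟩ := hσ
  -- `padΔ(U^u) = σ padΔ(U) σ⁻¹`
  have e : padDeltaCubeY i q par S (gaugeY i g U) = σu.1 * padDeltaCubeY i q par S U * σu⁻¹.1 := by
    have h' : padDeltaCubeY i q par S (gaugeY i g U) * σu.1 = σu.1 * padDeltaCubeY i q par S U := by rw [hσu]; exact h
    rw [← h', mul_assoc, Units.mul_inv, mul_one]
  rw [e]
  constructor
  · intro hu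
    have := (σu⁻¹).isUnit.mul (hu.mul σu.isUnit)
    simpa [mul_assoc] using this
  · intro hu
    exact (σu.isUnit.mul hu).mul (σu⁻¹).isUnit

end Cov

end Literature.MathematicalPhysics.QuantumFieldTheory.Balaban1983to89.B9Eq360PadDeltaCubeY

end
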